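import Summits.Ventures.Crystal3D.Theorems.StickyWulffConstantNoReconstructionGainGrainFrameThreeHigh
import Summits.Ventures.Crystal3D.Theorems.StickyWulffConstantNoReconstructionGainGrainFrameBudgetLow
import HarnessLib

/-!
# The cap budget of a moved fcc bond star: three contacts, and the stub `stub_frameCapBudget` by name

HONEST FRAMING. Part of the venture `Summits/Ventures/Crystal3D` (cell `crystal3d-full`), helper
`--supports` the crux `NoReconstructionGain` (stmt-Ventures-19144, route
`route-Ventures-StickyWulffConstant`), line `adhesion` (wulff-p1 g12).  THIS FILE CLOSES THE BRICK
`stub_frameCapBudget` OF SKELETON v15 BY NAME: the spherical CAP BUDGET of a moved bond star `A U₀` —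
at most three unit vectors `u` with `⟪u, ν⟫ ≤ −t`, pairwise `≥ 60°` apart, see at least as many star
directions that are down and steep-or-blocked, level blocked ones counting `½`.  With the landed rung
`grainFilm_slab_of_capBudget` (`…GrainFrame`) this gives `grainFilm_slab`: misoriented fcc-grain films
(film bonds in `A Λ₀`, film above the cut) gain nothing (`C = 0`) at EVERY normal — class (iii) of
the line's census, unconditionally.

* `inner_barlowPos_cubic` — inner products with lattice vectors in cubic coordinates:
  `2⟪(k,i,j), w⟫ = (i+j)A_w + (k+i)B_w + (k+j)C_w`.
* `contact_coords`, `contact_pair` — cubic coordinates of a contact pulled back by `A`: unit sphere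
  `x²+y²+z² = 2`, depth `ax+by+cz = −2⟪u, ν⟫`, blocking `2⟪u, A(k,i,j)⟫ = (i+j)x + (k+i)y + (k+j)z`,
  non-overlap `x x' + y y' + z z' = 2⟪u, u'⟫`.
* `frameCapBudget_three_sorted` — the budget for exactly three contacts, sorted pole: the coordinate
  theorem `capBudget_three_core` (`…GrainFrameThreeHigh`) with `Cr`/`Lv` instantiated by membership
  in the two filters, and the credits counted (`three_le_card_filter_of_triple`,
  `two_le_card_filter_of_pair`).
* `stub_frameCapBudget` (**the registered stub, by name**) — `#K ≤ 2` is the rung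
  `frameCapBudget_card_le_two`; `#K = 3` by the chamber step `exists_latticeIsometry_cubic_sorted_nonneg`.

WHAT THIS IS NOT: the crux `stub_adhesion_core` (the adhesion atom on cores) is untouched; rung F-C1
not moved.
-/

noncomputable section

namespace Summit.Ventures.Crystal3D.Theorems

open Summit.Ventures.Crystal3D Finset
open Literature.MathematicalPhysics.StatisticalMechanics (fccStacking barlowPos constHagg barlowPos_mem)
open scoped InnerProductSpace

/-- **Inner products with lattice vectors in cubic coordinates:**
`2⟪(k,i,j), w⟫ = (i+j)A_w + (k+i)B_w + (k+j)C_w`. -/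
theorem inner_barlowPos_cubic (k i j : ℤ) (w : EuclideanSpace ℝ (Fin 3)) :
    2 * ⟪barlowPos 1 (Real.sqrt (2 / 3)) constHagg k i j, w⟫_ℝ =
      ((i : ℝ) + j) * (w 0 + Real.sqrt 3 / 3 * w 1 - Real.sqrt (2 / 3) * w 2)
      + ((k : ℝ) + i) * (w 0 - Real.sqrt 3 / 3 * w 1 + Real.sqrt (2 / 3) * w 2)
      + ((k : ℝ) + j) * (2 * Real.sqrt 3 / 3 * w 1 + Real.sqrt (2 / 3) * w 2) := by
  obtain ⟨hu, hv, ht⟩ := inner_bonds_cubic w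
  rw [barlowPos_fcc_linear 1 _ k i j, inner_add_left, inner_add_left, real_inner_smul_left,
    real_inner_smul_left, real_inner_smul_left, hu, hv, ht]
  ring

/-- **Cubic coordinates of a contact** pulled back by the rotation `A`: unit sphere, depth, and the
blocking inner products with all moved lattice vectors. -/
theorem contact_coords (A : EuclideanSpace ℝ (Fin 3) ≃ₗᵢ[ℝ] EuclideanSpace ℝ (Fin 3))
    (ν S : EuclideanSpace ℝ (Fin 3)) (hS : S = A.symm (-ν)) (a b c : ℝ)
    (ha : a = S 0 + Real.sqrt 3 / 3 * S 1 - Real.sqrt (2 / 3) * S 2)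
    (hb : b = S 0 - Real.sqrt 3 / 3 * S 1 + Real.sqrt (2 / 3) * S 2)
    (hc : c = 2 * Real.sqrt 3 / 3 * S 1 + Real.sqrt (2 / 3) * S 2)
    (u : EuclideanSpace ℝ (Fin 3)) (hu : ‖u‖ = 1) :
    ∃ x y z : ℝ, x = (A.symm u) 0 + Real.sqrt 3 / 3 * (A.symm u) 1 - Real.sqrt (2 / 3) * (A.symm u) 2 ∧
      y = (A.symm u) 0 - Real.sqrt 3 / 3 * (A.symm u) 1 + Real.sqrt (2 / 3) * (A.symm u) 2 ∧
      z = 2 * Real.sqrt 3 / 3 * (A.symm u) 1 + Real.sqrt (2 / 3) * (A.symm u) 2 ∧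
      x ^ 2 + y ^ 2 + z ^ 2 = 2 ∧ a * x + b * y + c * z = -(2 * ⟪u, ν⟫_ℝ) ∧
      ∀ k i j : ℤ, 2 * ⟪u, A (barlowPos 1 (Real.sqrt (2 / 3)) constHagg k i j)⟫_ℝ =
        ((i : ℝ) + j) * x + ((k : ℝ) + i) * y + ((k : ℝ) + j) * z := by
  refine ⟨_, _, _, rfl, rfl, rfl, ?_, ?_, ?_⟩
  · have h := cubic_inner (A.symm u) (A.symm u)
    rw [real_inner_self_eq_norm_sq, LinearIsometryEquiv.norm_map, hu] at h
    nlinarith [h]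
  · have h := cubic_inner (A.symm u) S
    have h2 : ⟪A.symm u, S⟫_ℝ = -⟪u, ν⟫_ℝ := by
      rw [hS, ← A.inner_map_map, LinearIsometryEquiv.apply_symm_apply, LinearIsometryEquiv.apply_symm_apply,
        inner_neg_right]
    rw [h2, ← ha, ← hb, ← hc] at h
    linarith
  · intro k i j
    have h := inner_barlowPos_cubic k i j (A.symm u)
    rw [real_inner_comm, ← LinearIsometryEquiv.inner_map_map A, LinearIsometryEquiv.apply_symm_apply] at h
    linarith

/-- **Non-overlap in coordinates:** `x x' + y y' + z z' = 2⟪u, u'⟫`. -/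
theorem contact_pair (A : EuclideanSpace ℝ (Fin 3) ≃ₗᵢ[ℝ] EuclideanSpace ℝ (Fin 3))
    (u u' : EuclideanSpace ℝ (Fin 3)) {x y z x' y' z' : ℝ}
    (hx : x = (A.symm u) 0 + Real.sqrt 3 / 3 * (A.symm u) 1 - Real.sqrt (2 / 3) * (A.symm u) 2)
    (hy : y = (A.symm u) 0 - Real.sqrt 3 / 3 * (A.symm u) 1 + Real.sqrt (2 / 3) * (A.symm u) 2)
    (hz : z = 2 * Real.sqrt 3 / 3 * (A.symm u) 1 + Real.sqrt (2 / 3) * (A.symm u) 2)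
    (hx' : x' = (A.symm u') 0 + Real.sqrt 3 / 3 * (A.symm u') 1 - Real.sqrt (2 / 3) * (A.symm u') 2)
    (hy' : y' = (A.symm u') 0 - Real.sqrt 3 / 3 * (A.symm u') 1 + Real.sqrt (2 / 3) * (A.symm u') 2)
    (hz' : z' = 2 * Real.sqrt 3 / 3 * (A.symm u') 1 + Real.sqrt (2 / 3) * (A.symm u') 2) :
    x * x' + y * y' + z * z' = 2 * ⟪u, u'⟫_ℝ := by
  have h := cubic_inner (A.symm u) (A.symm u')
  rw [LinearIsometryEquiv.inner_map_map, ← hx, ← hy, ← hz, ← hx', ← hy', ← hz'] at h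
  linarith

/-- Distinct integer keys give distinct moved lattice vectors. -/
theorem movedStar_ne_of_key_ne (A : EuclideanSpace ℝ (Fin 3) ≃ₗᵢ[ℝ] EuclideanSpace ℝ (Fin 3))
    {p q : ℤ × ℤ × ℤ} (h : p ≠ q) :
    A (barlowPos 1 (Real.sqrt (2 / 3)) constHagg p.1 p.2.1 p.2.2) ≠
      A (barlowPos 1 (Real.sqrt (2 / 3)) constHagg q.1 q.2.1 q.2.2) := by
  intro he
  have h1 := barlowPos_fcc_injective (A.injective he)
  obtain ⟨p1, p2, p3⟩ := p
  obtain ⟨q1, q2, q3⟩ := q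
  exact h h1

set_option maxHeartbeats 800000 in
/-- **The cap budget for three contacts, sorted pole.**  See the module docstring. -/
theorem frameCapBudget_three_sorted (U₀ : Finset (EuclideanSpace ℝ (Fin 3)))
    (hU₀ : ∀ d ∈ U₀, d ∈ fccStacking 1 (Real.sqrt (2 / 3)) ∧ ‖d‖ = 1) (hU₀card : U₀.card = 12)
    (A : EuclideanSpace ℝ (Fin 3) ≃ₗᵢ[ℝ] EuclideanSpace ℝ (Fin 3))
    (ν : EuclideanSpace ℝ (Fin 3)) (hν : ‖ν‖ = 1) (t : ℝ) (ht : 0 < t)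
    (K : Finset (EuclideanSpace ℝ (Fin 3))) (hK : K.card = 3)
    (hK1 : ∀ u ∈ K, ‖u‖ = 1 ∧ ⟪u, ν⟫_ℝ ≤ -t) (hK2 : ∀ u ∈ K, ∀ u' ∈ K, u ≠ u' → ⟪u, u'⟫_ℝ ≤ 1 / 2)
    (hsort : 0 ≤ (A.symm (-ν)) 0 + Real.sqrt 3 / 3 * (A.symm (-ν)) 1 - Real.sqrt (2 / 3) * (A.symm (-ν)) 2 ∧
      (A.symm (-ν)) 0 + Real.sqrt 3 / 3 * (A.symm (-ν)) 1 - Real.sqrt (2 / 3) * (A.symm (-ν)) 2 ≤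
        (A.symm (-ν)) 0 - Real.sqrt 3 / 3 * (A.symm (-ν)) 1 + Real.sqrt (2 / 3) * (A.symm (-ν)) 2 ∧
      (A.symm (-ν)) 0 - Real.sqrt 3 / 3 * (A.symm (-ν)) 1 + Real.sqrt (2 / 3) * (A.symm (-ν)) 2 ≤
        2 * Real.sqrt 3 / 3 * (A.symm (-ν)) 1 + Real.sqrt (2 / 3) * (A.symm (-ν)) 2) :
    (3 : ℝ) ≤
      (((U₀.image fun d => A d).filter fun d =>
          ⟪d, ν⟫_ℝ < 0 ∧ ((∃ u ∈ K, 1 / 2 < ⟪u, d⟫_ℝ) ∨ ⟪d, ν⟫_ℝ ≤ -t)).card : ℝ)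
        + (1 / 2) * (((U₀.image fun d => A d).filter fun d =>
          ⟪d, ν⟫_ℝ = 0 ∧ ∃ u ∈ K, 1 / 2 < ⟪u, d⟫_ℝ).card : ℝ) := by
  classical
  set S := A.symm (-ν) with hSdef
  set a := S 0 + Real.sqrt 3 / 3 * S 1 - Real.sqrt (2 / 3) * S 2 with hadef
  set b := S 0 - Real.sqrt 3 / 3 * S 1 + Real.sqrt (2 / 3) * S 2 with hbdef
  set c := 2 * Real.sqrt 3 / 3 * S 1 + Real.sqrt (2 / 3) * S 2 with hcdef
  obtain ⟨ha, hab, hbc⟩ := hsort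
  have hSn : ‖S‖ = 1 := by rw [hSdef, LinearIsometryEquiv.norm_map, norm_neg, hν]
  have hS2 : a ^ 2 + b ^ 2 + c ^ 2 = 2 := by
    have h := cubic_inner S S
    rw [real_inner_self_eq_norm_sq, hSn] at h
    rw [hadef, hbdef, hcdef]; nlinarith [h]
  -- depths of the moved lattice directions
  have hνS : ∀ w : EuclideanSpace ℝ (Fin 3), ⟪A w, ν⟫_ℝ = -⟪w, S⟫_ℝ := by
    intro w
    have : ⟪w, S⟫_ℝ = -⟪A w, ν⟫_ℝ := by
      rw [hSdef, ← A.inner_map_map, LinearIsometryEquiv.apply_symm_apply, inner_neg_right]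
    linarith
  have hdep : ∀ k i j : ℤ, 2 * ⟪A (barlowPos 1 (Real.sqrt (2 / 3)) constHagg k i j), ν⟫_ℝ =
      -(((i : ℝ) + j) * a + ((k : ℝ) + i) * b + ((k : ℝ) + j) * c) := by
    intro k i j
    have h := inner_barlowPos_cubic k i j S
    rw [← hadef, ← hbdef, ← hcdef] at h
    rw [hνS]; linarith
  -- the three contacts
  obtain ⟨u₁, u₂, u₃, n12, n13, n23, hKe⟩ := card_eq_three.1 hK
  have m1 : u₁ ∈ K := by rw [hKe]; simp
  have m2 : u₂ ∈ K := by rw [hKe]; simp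
  have m3 : u₃ ∈ K := by rw [hKe]; simp
  obtain ⟨x₁, y₁, z₁, hx₁, hy₁, hz₁, hu₁, hd₁, hb₁⟩ :=
    contact_coords A ν S hSdef a b c hadef hbdef hcdef u₁ (hK1 u₁ m1).1
  obtain ⟨x₂, y₂, z₂, hx₂, hy₂, hz₂, hu₂, hd₂, hb₂⟩ :=
    contact_coords A ν S hSdef a b c hadef hbdef hcdef u₂ (hK1 u₂ m2).1
  obtain ⟨x₃, y₃, z₃, hx₃, hy₃, hz₃, hu₃, hd₃, hb₃⟩ :=
    contact_coords A ν S hSdef a b c hadef hbdef hcdef u₃ (hK1 u₃ m3).1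
  have hδ₁ : 2 * t ≤ a * x₁ + b * y₁ + c * z₁ := by rw [hd₁]; linarith [(hK1 u₁ m1).2]
  have hδ₂ : 2 * t ≤ a * x₂ + b * y₂ + c * z₂ := by rw [hd₂]; linarith [(hK1 u₂ m2).2]
  have hδ₃ : 2 * t ≤ a * x₃ + b * y₃ + c * z₃ := by rw [hd₃]; linarith [(hK1 u₃ m3).2]
  have h12 : x₁ * x₂ + y₁ * y₂ + z₁ * z₂ ≤ 1 := by
    rw [contact_pair A u₁ u₂ hx₁ hy₁ hz₁ hx₂ hy₂ hz₂]; linarith [hK2 u₁ m1 u₂ m2 n12]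
  have h13 : x₁ * x₃ + y₁ * y₃ + z₁ * z₃ ≤ 1 := by
    rw [contact_pair A u₁ u₃ hx₁ hy₁ hz₁ hx₃ hy₃ hz₃]; linarith [hK2 u₁ m1 u₃ m3 n13]
  have h23 : x₂ * x₃ + y₂ * y₃ + z₂ * z₃ ≤ 1 := by
    rw [contact_pair A u₂ u₃ hx₂ hy₂ hz₂ hx₃ hy₃ hz₃]; linarith [hK2 u₂ m2 u₃ m3 n23]
  -- the coordinate theorem, with the credit predicates = membership in the two filters
  have core := capBudget_three_core (T := 2 * t)
    (Cr := fun q : ℤ × ℤ × ℤ =>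
      A (barlowPos 1 (Real.sqrt (2 / 3)) constHagg q.1 q.2.1 q.2.2) ∈ (U₀.image fun d => A d) ∧
      (⟪A (barlowPos 1 (Real.sqrt (2 / 3)) constHagg q.1 q.2.1 q.2.2), ν⟫_ℝ < 0 ∧
        ((∃ u ∈ K, 1 / 2 < ⟪u, A (barlowPos 1 (Real.sqrt (2 / 3)) constHagg q.1 q.2.1 q.2.2)⟫_ℝ) ∨
          ⟪A (barlowPos 1 (Real.sqrt (2 / 3)) constHagg q.1 q.2.1 q.2.2), ν⟫_ℝ ≤ -t)))
    (Lv := fun q : ℤ × ℤ × ℤ =>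
      A (barlowPos 1 (Real.sqrt (2 / 3)) constHagg q.1 q.2.1 q.2.2) ∈ (U₀.image fun d => A d) ∧
      (⟪A (barlowPos 1 (Real.sqrt (2 / 3)) constHagg q.1 q.2.1 q.2.2), ν⟫_ℝ = 0 ∧
        ∃ u ∈ K, 1 / 2 < ⟪u, A (barlowPos 1 (Real.sqrt (2 / 3)) constHagg q.1 q.2.1 q.2.2)⟫_ℝ))
    ha hab hbc hS2 hu₁ hu₂ hu₃ h12 h13 h23 hδ₁ hδ₂ hδ₃ ?_ ?_ (by linarith)
  rotate_left
  · -- `hCr`: strictly down and blocked-or-steep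
    intro k i j e₁ e₂ e₃ he₁ he₂ he₃ hn hpos hdisj
    dsimp only
    have hD := hdep k i j
    rw [← he₁, ← he₂, ← he₃] at hD
    refine ⟨movedStar_mem_of_coords U₀ hU₀ hU₀card A hn, by linarith, ?_⟩
    have B1 := hb₁ k i j; have B2 := hb₂ k i j; have B3 := hb₃ k i j
    rw [← he₁, ← he₂, ← he₃] at B1 B2 B3
    rcases hdisj with h | h | h | h
    · exact Or.inl ⟨u₁, m1, by linarith⟩
    · exact Or.inl ⟨u₂, m2, by linarith⟩
    · exact Or.inl ⟨u₃, m3, by linarith⟩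
    · exact Or.inr (by linarith)
  · -- `hLv`: level and blocked
    intro k i j e₁ e₂ e₃ he₁ he₂ he₃ hn hzero hdisj
    dsimp only
    have hD := hdep k i j
    rw [← he₁, ← he₂, ← he₃] at hD
    refine ⟨movedStar_mem_of_coords U₀ hU₀ hU₀card A hn, by linarith, ?_⟩
    have B1 := hb₁ k i j; have B2 := hb₂ k i j; have B3 := hb₃ k i j
    rw [← he₁, ← he₂, ← he₃] at B1 B2 B3
    rcases hdisj with h | h | h
    · exact ⟨u₁, m1, by linarith⟩
    · exact ⟨u₂, m2, by linarith⟩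
    · exact ⟨u₃, m3, by linarith⟩
  -- count the credits
  have hnn : (0 : ℝ) ≤ (((U₀.image fun d => A d).filter fun d =>
      ⟪d, ν⟫_ℝ = 0 ∧ ∃ u ∈ K, 1 / 2 < ⟪u, d⟫_ℝ).card : ℝ) := Nat.cast_nonneg _
  rcases core with ⟨p₁, p₂, p₃, n₁, n₂, n₃, C₁, C₂, C₃⟩ | ⟨p₁, p₂, l₁, l₂, n₁, n₂, C₁, C₂, L₁, L₂⟩
  · have h3 := three_le_card_filter_of_triple C₁.1 C₂.1 C₃.1 (movedStar_ne_of_key_ne A n₁)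
      (movedStar_ne_of_key_ne A n₂) (movedStar_ne_of_key_ne A n₃)
      (P := fun d => ⟪d, ν⟫_ℝ < 0 ∧ ((∃ u ∈ K, 1 / 2 < ⟪u, d⟫_ℝ) ∨ ⟪d, ν⟫_ℝ ≤ -t)) C₁.2 C₂.2 C₃.2
    have h3' : (3 : ℝ) ≤ (((U₀.image fun d => A d).filter fun d =>
        ⟪d, ν⟫_ℝ < 0 ∧ ((∃ u ∈ K, 1 / 2 < ⟪u, d⟫_ℝ) ∨ ⟪d, ν⟫_ℝ ≤ -t)).card : ℝ) := by
      exact_mod_cast h3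
    linarith
  · have h2 := two_le_card_filter_of_pair C₁.1 C₂.1 (movedStar_ne_of_key_ne A n₁)
      (P := fun d => ⟪d, ν⟫_ℝ < 0 ∧ ((∃ u ∈ K, 1 / 2 < ⟪u, d⟫_ℝ) ∨ ⟪d, ν⟫_ℝ ≤ -t)) C₁.2 C₂.2
    have h2l := two_le_card_filter_of_pair L₁.1 L₂.1 (movedStar_ne_of_key_ne A n₂)
      (P := fun d => ⟪d, ν⟫_ℝ = 0 ∧ ∃ u ∈ K, 1 / 2 < ⟪u, d⟫_ℝ) L₁.2 L₂.2
    have h2' : (2 : ℝ) ≤ (((U₀.image fun d => A d).filter fun d =>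
        ⟪d, ν⟫_ℝ < 0 ∧ ((∃ u ∈ K, 1 / 2 < ⟪u, d⟫_ℝ) ∨ ⟪d, ν⟫_ℝ ≤ -t)).card : ℝ) := by
      exact_mod_cast h2
    have h2l' : (2 : ℝ) ≤ (((U₀.image fun d => A d).filter fun d =>
        ⟪d, ν⟫_ℝ = 0 ∧ ∃ u ∈ K, 1 / 2 < ⟪u, d⟫_ℝ).card : ℝ) := by
      exact_mod_cast h2l
    linarith

/-- **THE REGISTERED STUB `stub_frameCapBudget` OF SKELETON v15, BY NAME: the spherical cap budget
of a moved fcc bond star** — every `t > 0`, every rotation `A`, every unit normal `ν`, at most three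
contacts pairwise `≥ 60°` apart. -/
theorem stub_frameCapBudget :
    ∀ U₀ : Finset (EuclideanSpace ℝ (Fin 3)),
      (∀ d ∈ U₀, d ∈ fccStacking 1 (Real.sqrt (2 / 3)) ∧ ‖d‖ = 1) → (∀ d ∈ U₀, -d ∈ U₀) → U₀.card = 12 →
      ∀ A : EuclideanSpace ℝ (Fin 3) ≃ₗᵢ[ℝ] EuclideanSpace ℝ (Fin 3),
      ∀ ν : EuclideanSpace ℝ (Fin 3), ‖ν‖ = 1 → ∀ t : ℝ, 0 < t →
        ∀ K : Finset (EuclideanSpace ℝ (Fin 3)), K.card ≤ 3 →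
        (∀ u ∈ K, ‖u‖ = 1 ∧ ⟪u, ν⟫_ℝ ≤ -t) → (∀ u ∈ K, ∀ u' ∈ K, u ≠ u' → ⟪u, u'⟫_ℝ ≤ 1 / 2) →
        (K.card : ℝ) ≤
          (((U₀.image fun d => A d).filter fun d =>
              ⟪d, ν⟫_ℝ < 0 ∧ ((∃ u ∈ K, 1 / 2 < ⟪u, d⟫_ℝ) ∨ ⟪d, ν⟫_ℝ ≤ -t)).card : ℝ)
            + (1 / 2) * (((U₀.image fun d => A d).filter fun d =>
              ⟪d, ν⟫_ℝ = 0 ∧ ∃ u ∈ K, 1 / 2 < ⟪u, d⟫_ℝ).card : ℝ) := by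
  classical
  intro U₀ hU₀ hU₀neg hU₀card A ν hν t ht K hK hK1 hK2
  rcases Nat.lt_or_ge K.card 3 with hlt | hge
  · exact frameCapBudget_card_le_two U₀ hU₀ hU₀neg hU₀card A ν hν t ht K (by omega) hK1 hK2
  have hK3 : K.card = 3 := le_antisymm hK hge
  -- chamber: replace `A` by `A ∘ g⁻¹` with the cubic coordinates of `g (A⁻¹ (−ν))` sorted
  obtain ⟨fA, hfA⟩ : ∃ f : EuclideanSpace ℝ (Fin 3) → ℝ,
      ∀ x, f x = x 0 + Real.sqrt 3 / 3 * x 1 - Real.sqrt (2 / 3) * x 2 := ⟨_, fun x => rfl⟩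
  obtain ⟨fB, hfB⟩ : ∃ f : EuclideanSpace ℝ (Fin 3) → ℝ,
      ∀ x, f x = x 0 - Real.sqrt 3 / 3 * x 1 + Real.sqrt (2 / 3) * x 2 := ⟨_, fun x => rfl⟩
  obtain ⟨fC, hfC⟩ : ∃ f : EuclideanSpace ℝ (Fin 3) → ℝ,
      ∀ x, f x = 2 * Real.sqrt 3 / 3 * x 1 + Real.sqrt (2 / 3) * x 2 := ⟨_, fun x => rfl⟩
  obtain ⟨g, hG, h1, h2, h3⟩ := exists_latticeIsometry_cubic_sorted_nonneg fA fB fC hfA hfB hfC (A.symm (-ν))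
  set A' : EuclideanSpace ℝ (Fin 3) ≃ₗᵢ[ℝ] EuclideanSpace ℝ (Fin 3) := g.symm.trans A with hA'
  have hA'symm : A'.symm (-ν) = g (A.symm (-ν)) := by rw [hA']; rfl
  have hUeq : (U₀.image fun d => A d) = U₀.image fun d => A' d := by
    ext d
    simp only [mem_image]
    constructor
    · rintro ⟨d₀, hd₀, rfl⟩
      refine ⟨g d₀, fcc_unit_mem_of_bondStar U₀ hU₀ hU₀card (hG.1 d₀ (hU₀ d₀ hd₀).1)
        (by rw [LinearIsometryEquiv.norm_map]; exact (hU₀ d₀ hd₀).2), ?_⟩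
      rw [hA', LinearIsometryEquiv.trans_apply, LinearIsometryEquiv.symm_apply_apply]
    · rintro ⟨d₀, hd₀, rfl⟩
      refine ⟨g.symm d₀, fcc_unit_mem_of_bondStar U₀ hU₀ hU₀card (hG.2 d₀ (hU₀ d₀ hd₀).1)
        (by rw [LinearIsometryEquiv.norm_map]; exact (hU₀ d₀ hd₀).2), ?_⟩
      rw [hA', LinearIsometryEquiv.trans_apply]
  rw [hUeq, hK3]
  have hsort : 0 ≤ (A'.symm (-ν)) 0 + Real.sqrt 3 / 3 * (A'.symm (-ν)) 1 - Real.sqrt (2 / 3) * (A'.symm (-ν)) 2 ∧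
      (A'.symm (-ν)) 0 + Real.sqrt 3 / 3 * (A'.symm (-ν)) 1 - Real.sqrt (2 / 3) * (A'.symm (-ν)) 2 ≤
        (A'.symm (-ν)) 0 - Real.sqrt 3 / 3 * (A'.symm (-ν)) 1 + Real.sqrt (2 / 3) * (A'.symm (-ν)) 2 ∧
      (A'.symm (-ν)) 0 - Real.sqrt 3 / 3 * (A'.symm (-ν)) 1 + Real.sqrt (2 / 3) * (A'.symm (-ν)) 2 ≤
        2 * Real.sqrt 3 / 3 * (A'.symm (-ν)) 1 + Real.sqrt (2 / 3) * (A'.symm (-ν)) 2 := by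
    rw [hA'symm, ← hfA, ← hfB, ← hfC]; exact ⟨h1, h2, h3⟩
  have h := frameCapBudget_three_sorted U₀ hU₀ hU₀card A' ν hν t ht K hK3 hK1 hK2 hsort
  push_cast
  linarith

end Summit.Ventures.Crystal3D.Theorems

end
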